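import Literature.MathematicalPhysics.QuantumFieldTheory.Balaban1983to89.B8Eq131CubesRec
import Literature.MathematicalPhysics.QuantumFieldTheory.Balaban1983to89.B8Prop6OfThm4

/-!
# `Balaban1983to89.B8Prop6OfThm4Rec` — [Balaban1985RegularSpaces] p. 99: «the assumptions of Theorem 4 are satisfied for the pair of configurations 1, U₀″» —
# Proposition 6 ((1.134)–(1.138)) from (1.132)∕(1.133) and Theorem 4 (p. 88), FOR THE RECORD's AVERAGING STRUCTURE ([Balaban1987RG1] (0.3)–(0.4): centred blocks,
# symmetric loop averages, centre-rooted axial data) — the record twin of `B8Prop6OfThm4` (LEAD PEN dag-n05-e, «N05-REC» road item R6, file 1)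

statement-level skeleton of published theorems with citation tags; proofs where landed; nothing here is a claim about the Yang–Mills mass gap

CITATION HEADER (lean-in-tree rule).  Cell `pub-ymgap` (HUMAN RULING D-0062), «N05-REC» road (director-ym №254∕№255; LEAD PEN dag-n05-e g37; `N05-REC-LEAD.md` TOKEN RULE T1–T6;
`N05-REC-INVENTORY.md` §R6 row `B8Prop6OfThm4 — A: localGauge_mem, Cond166, cond166_one_iff, tavg, tavg_one`).  [6] = [Balaban1985RegularSpaces] Sect. F pp. 98–99 (1.128)–(1.138),
Thm. 4 p. 88, (1.20) p. 79, (1.29) p. 81, (1.33)–(1.34) p. 82, (1.66) p. 87 (`paper:balaban1985-cmp99-regular-spaces`); [3] = [Balaban1985Averaging] Prop. 2 p. 26; [I] = [Balaban1987RG1]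
(0.3)–(0.4) pp. 252–253.  `--kind definition --supports stmt-QuantumFields-20541` (K0⁷; count-neutral; three `def`s: `tavgZ`, `Cond166CubeZ`, `Thm4AtOneZ`).

THE TOKEN MAP (engine `B8Prop6OfThm4` → this file): (T1) `avgIter ↦ BlockAveragingZd.avgIterZ`, `localGauge ↦ B8Eq115GaugeFixingRec.localGaugeZ`, `towerGauge ↦ towerGaugeZ`, `cutFixed ↦
B8Ineq133Rec.cutFixedZ`, `InAxOne ↦ B8Eq119TwistedAxialRec.InAxOneZ`, `AvgClosed ↦ B7Prop2Rec.AvgClosedZ`, `C0 ↦ C0Z`; (T2) `cube ∕ tcube ∕ box ∕ LamP ∕ sqLo ∕ sqHi ∕ bLo ∕ bHi ↦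
B8Eq131CubesRec.cubeZ ∕ tcubeZ ∕ boxZ ∕ LamPZ ∕ sqLoZ ∕ sqHiZ ∕ bLoZ ∕ bHiZ`, `B8Ineq130.tlo ∕ thi ↦ B8Ineq130Rec.tlo ∕ thi` (centred tower; odd `L = 2s + 1`); (T3) the axial data are
SHARED — the global axial gauge of `Ū₀′ᵏ` at the centre `y` is the engine's `treeWord (z − y)` system (`B8Ineq129.ineq137_log_printed` reused verbatim); (T5) names kept inside this
namespace with the cell's `Z` suffix on the three definitions; (T6) class-0 letters reused BY NAME: `InAk ∕ CondAt` ((1.7)∕(1.9): fine plaquettes and covariant divergences, no averaging),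
`agree135`, `smallness_134`, `const_136`, `one_inAk`, `pdevOn_lt_of_inAk_top` (engine `B8Prop6OfThm4`), `clampCfg ∕ cutCfg` bookkeeping, `ctr ∕ tLo ∕ tHi`.
REUSED RECORD THEOREMS (cell members dag-n05-d ∕ dag-n05-e, all landed): `B8Eq131CubesRec.ineq132_cubes` ((1.132)∕(1.133) on the record tower), `B8Ineq128Rec.{gaugeFix_global,
ineq128_global, ineq128_local}`, `B8Ineq133Rec.avgIterZ_eq_of_agree`, `B8Ineq132Rec.pdevOn_lt_of_inAk_box`, `B7Prop2Rec.{AvgClosedZ, C0Z, C0Z_pos}`, `BlockAveragingZd.avgIterZ_one`.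

WHAT IS DEFINED ∕ PROVED (sorry-free).  §1 `tavgZ` ∕ `tavgZ_one` — (1.20) bondwise for the record averages, `Ũ′ⁿ = Ū′ⁿ` at `U₀ = 1`; `Cond166CubeZ` ∕ `cond166CubeZ_one_iff` — (1.66) for the pair
`1, U′` on the record family `{□_j}` IS the shape of (1.133).  §2 `Thm4AtOneZ` — THE INTERFACE (HYPOTHESIS SHAPE): Theorem 4 for the background `1` and the record family `{□_j}`, `ℭ_k` of
(1.131) (`cubeZ`, `LamPZ`), with (1.34)'s `Ax`-part as `InAxOneZ` and (1.66) as `Cond166CubeZ`, the Landau-gauge notions abstract (`Restr`, `Concl`) — the signature the record's Theorem-4 driver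
(R5, dag-n05-c) is to INSTANTIATE and Proposition 6 for the record consumes.  §3 `localGaugeZ_mem` (the gauge `v` of p. 98 is `G`-valued, record tower); ★★★ `prop6_of_thm4` — PROPOSITION 6
FROM THEOREM 4 FOR THE RECORD: `U₀″ = cutFixedZ …` satisfies `Thm4AtOneZ`'s hypotheses with `(α₀, α₁) ↦ (L³α₀, 6dL²Mα₀)` (`ineq132_cubes`, `one_inAk`), so the gauge `u` exists, uniquely,
`G`-valued, with `Restr u`, `Concl …`, `w := v⁻¹u` `G`-valued and (1.135) `U₀^{w⁻¹} = U₀″^{u⁻¹}` on the bonds of the centred `□̃`; `prop6_of_thm4_printed` (printed smallness `7dL²Mα₀ ≤ c₁`,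
`L ≤ dM`).  §4 ★ `ineq137_cube` — (1.137), THE INEQUALITIES, for THIS `U₀′` and the record averages, independently of Theorem 4: on every bond `⟨x, x + e_μ⟩ ⊂ □^{(k)}`:
`\overline{U₀″}ᵏ = Ū₀′ᵏ`, `‖(1∕i) log Ū₀′ᵏ(x, x + e_μ)‖ ≤ |x − y|₁·4α₀ ≤ 2dMα₀` (`y = ctr a M`; [3] Prop. 2 for the record localised + the shared axial gauge at `y`).
HONEST SCOPE.  Exactly the engine module's content under the token map; Theorem 4 for the record is the HYPOTHESIS `Thm4AtOneZ` (never instantiated here); nothing of [6]∕[3]∕[I]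
asserted beyond (1.132)–(1.133)∕(1.135)∕(1.137)'s bookkeeping; `HThm4Rec` UNDISCHARGED; N05 discharged of record untouched; N07 not claimable; counts unmoved (typed 28∕28 · discharged
8∕28); one finite 𝕋⁴ programme at fixed ε — nothing continuum ∕ ℝ⁴ ∕ OS ∕ mass gap ∕ Clay.  Three `def`s, no `instance`, no `notation`, no `sorry`.
-/

noncomputable section

open scoped BigOperators
open Finset

namespace Literature.MathematicalPhysics.QuantumFieldTheory.Balaban1983to89.B8Prop6OfThm4Rec

open B7Prop1Explicit B7Prop2Explicit B7Prop1Local B7AvgGaugeCovariance MatrixLog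
open BlockAveragingZd (avgIterZ avgIterZ_one offZ ctrShift)
open B7Prop2Rec (AvgClosedZ C0Z C0Z_pos)
open B8Ineq130 (gaugeAct_one aLev inBox_of_le)
open B8Ineq130Rec (tlo thi tlo_le_thi)
open B8Ineq133 (cutCfg cutCfg_mem cutCfg_agree pdevOn_congr)
open B8Ineq133Rec (cutFixedZ avgIterZ_eq_of_agree)
open B8Eq115GaugeFixing (gaugeAct_mem_of gaugeAct_agree pdevOn_gaugeAct)
open B8Eq115GaugeFixingRec (towerGaugeZ localGaugeZ)
open B8Ineq128Rec (ineq128_global ineq128_local)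
open B8Ineq132 (InAk)
open B8Ineq132Rec (pdevOn_lt_of_inAk_box)
open B8Eq119TwistedAxialRec (InAxOneZ)
open B8Eq131Cubes (tLo tHi ctr tLo_le_tHi)
open B8Eq131CubesRec (bLoZ bHiZ sqLoZ sqHiZ boxZ cubeZ tcubeZ LamPZ ineq132_cubes tlo_tLo thi_tHi tlo_bLo thi_bHi le_of_margin_mono tLo_eq tHi_eq)
open B8Ineq129 (ineq137_log_printed)
open B8Prop6OfThm4 (agree135 smallness_134 const_136 one_inAk pdevOn_lt_of_inAk_top)
open B7Eq78Linearization (conjR conjR_apply)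
export B7Prop1Explicit (Site)

variable {d : ℕ}

section Analytic

variable {𝔸 : Type*} [NormedRing 𝔸] [NormOneClass 𝔸] [NormedAlgebra ℂ 𝔸] [CompleteSpace 𝔸]

/-! ## §1. (1.20) and (1.66) for the pair `1, U′` on the record family `{□_j}` -/

omit [NormOneClass 𝔸] in
/-- (RECORD TWIN of `B8Prop6OfThm4.tavg`.) **(1.20)**, bondwise, RECORD averages: `Ũ′ⁿ = (\overline{U′U₀})ⁿ(Ū₀ⁿ)⁻¹` with the `n`-fold average `avgIterZ` of [I] (0.4).
[cite: Balaban1985RegularSpaces, (1.20) p.79; Balaban1987RG1, (0.4) p.253] -/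
def tavgZ (L : ℕ) (U₀ U' : Site d → Fin d → 𝔸ˣ) (n : ℕ) : Site d → Fin d → 𝔸ˣ :=
  fun x κ => avgIterZ L (U' * U₀) n x κ * (avgIterZ L U₀ n x κ)⁻¹

omit [NormOneClass 𝔸] in
/-- For the background `U₀ = 1`: `Ũ′ⁿ = Ū′ⁿ` (`U′·1 = U′`, `\overline{1}ⁿ = 1` for the record average, `BlockAveragingZd.avgIterZ_one`).
[cite: Balaban1985RegularSpaces, (1.20) p.79, p.99 ("the pair of configurations 1, U₀″"); Balaban1987RG1, (0.4) p.253] -/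
theorem tavgZ_one (L : ℕ) (U' : Site d → Fin d → 𝔸ˣ) (n : ℕ) :
    tavgZ L (1 : Site d → Fin d → 𝔸ˣ) U' n = avgIterZ L U' n := by
  funext x κ
  simp only [tavgZ, mul_one, avgIterZ_one, Pi.one_apply, inv_one]

omit [NormOneClass 𝔸] in
/-- (RECORD TWIN of `B8Prop6OfThm4.Cond166`; named `Cond166CubeZ` because `B7SectEFLinearisationRec.Cond166Z` is [Balaban1985Averaging] (166), a different condition.) **(1.66) for the
admissible record family `{□_j}`** (`cubeZ`; the `Ω_j` of Theorem 4 applied on p. 99): `|Ũ′ʲ − 1| < α₁` on the bonds `⟨x, x + e_ν⟩` of `□_j^{(j)} = [sqLoZ j, sqHiZ j]`, `j = 0, 1, …, k`,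
record averages. [cite: Balaban1985RegularSpaces, (1.66) p.87, p.99; Balaban1987RG1, (0.4) p.253] -/
def Cond166CubeZ (L k : ℕ) (a : Site d) (M ρ : ℕ) (U₀ U' : Site d → Fin d → 𝔸ˣ) (α₁ : ℝ) : Prop :=
  ∀ j, j ≤ k → ∀ (x : Site d) (ν : Fin d), sqLoZ L a ρ k j ≤ x → x + e ν ≤ sqHiZ L a M ρ k j →
    ‖((tavgZ L U₀ U' j x ν : 𝔸ˣ) : 𝔸) - 1‖ < α₁

omit [NormOneClass 𝔸] in
/-- **(1.66) for the pair `1, U′` IS the shape of (1.133)**, record averages: `|Ū′ʲ − 1| < α₁` on `□_j^{(j)}`, `j = 0, …, k` (the third member of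
`B8Eq131CubesRec.ineq132_cubes`). [cite: Balaban1985RegularSpaces, (1.66) p.87, (1.133) p.99; Balaban1987RG1, (0.4) p.253] -/
theorem cond166CubeZ_one_iff (L k : ℕ) (a : Site d) (M ρ : ℕ) (U' : Site d → Fin d → 𝔸ˣ) (α₁ : ℝ) :
    Cond166CubeZ L k a M ρ (1 : Site d → Fin d → 𝔸ˣ) U' α₁ ↔
      ∀ j, j ≤ k → ∀ (x : Site d) (ν : Fin d), sqLoZ L a ρ k j ≤ x → x + e ν ≤ sqHiZ L a M ρ k j →
        ‖((avgIterZ L U' j x ν : 𝔸ˣ) : 𝔸) - 1‖ < α₁ := by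
  simp only [Cond166CubeZ, tavgZ_one]

/-! ## §2. THE INTERFACE: Theorem 4 (p. 88) for the background `1` and the record family `{□_j}` of (1.131) -/

omit [NormOneClass 𝔸] in
/-- (RECORD TWIN of `B8Prop6OfThm4.Thm4AtOne`.) **INTERFACE (HYPOTHESIS SHAPE) — Theorem 4, p. 88, specialised to `U₀ = 1`, `Ω_j = □_j` (`B8Eq131CubesRec.cubeZ`, centred tower),
`𝔅_k = ℭ_k = ⋃ Λ′_j` (`B8Eq131CubesRec.LamPZ`), FOR THE RECORD's AVERAGING STRUCTURE**: «for arbitrary `U₀`, `U′U₀` satisfying (1.33), (1.34), (1.66) with `α₀ + α₁ ≤ c₁` there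
exists exactly one gauge transformation `u` satisfying (1.29) and such that the conditions (1.37), (1.38), (1.62) hold for the configuration `U₁ = U′^{u⁻¹}`».  For the pair `1, U′`:
(1.33) = `1 ∈ 𝔄_k({□_j}, α₀)`; (1.34) = `U′ ∈ 𝔄_k({□_j}, α₀) ∩ Ax_k(ℭ_k, 1)` with the RECORD axial predicate `InAxOneZ` (record averages `Ū′ʲ`, centred blocks, centre-rooted
staircases); (1.66) = `Cond166CubeZ … 1 U′ α₁`; `Restr u` abstracts «`u` satisfies (1.29) w.r.t. `{Λ′_j}`» (record: `Restr129Z`-shaped), `Concl α₀ α₁ U′ u` abstracts «(1.37), (1.38),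
(1.62) hold for `U₁ = U′^{u⁻¹}`» (record letters); `u` ranges over `G`-valued gauge transformations.  A HYPOTHESIS of `prop6_of_thm4` — the consumer signature of the record's
Theorem-4 driver (road R5); never instantiated in this file. [cite: Balaban1985RegularSpaces, Thm. 4 p.88, (1.33)-(1.34) p.82, (1.66) p.87, (1.29) p.81; Balaban1987RG1, (0.4) p.253] -/
def Thm4AtOneZ (L k : ℕ) (η c₁ : ℝ) (G : Subgroup 𝔸ˣ) (a : Site d) (M ρ : ℕ)
    (Restr : (Site d → 𝔸ˣ) → Prop) (Concl : ℝ → ℝ → (Site d → Fin d → 𝔸ˣ) → (Site d → 𝔸ˣ) → Prop) : Prop :=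
  ∀ ⦃α₀ α₁ : ℝ⦄, 0 < α₀ → 0 < α₁ → α₀ + α₁ ≤ c₁ →
    ∀ U' : Site d → Fin d → 𝔸ˣ, (∀ x κ, U' x κ ∈ G) →
      InAk L k η α₀ (cubeZ L a M ρ k) (1 : Site d → Fin d → 𝔸ˣ) →
      InAk L k η α₀ (cubeZ L a M ρ k) U' → InAxOneZ L k (LamPZ L a M ρ k) U' →
      Cond166CubeZ L k a M ρ (1 : Site d → Fin d → 𝔸ˣ) U' α₁ →
      ∃ u : Site d → 𝔸ˣ, ((∀ x, u x ∈ G) ∧ Restr u ∧ Concl α₀ α₁ U' u) ∧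
        ∀ u' : Site d → 𝔸ˣ, (∀ x, u' x ∈ G) → Restr u' → Concl α₀ α₁ U' u' → u' = u

/-! ## §3. Proposition 6 from Theorem 4, record structure: existence of `u`, (1.135) -/

/-- (RECORD TWIN of `B8Prop6OfThm4.localGauge_mem`.) The gauge transformation `v` of p. 98 for the record tower (`U₀′ = U₀^{v}`, `B8Eq115GaugeFixingRec.localGaugeZ` on the
centred `□̃ = [tlo k, thi k]`) is `G`-valued, from (1.7) on the plaquettes of `□̃` alone (`B8Ineq128Rec.gaugeFix_global` on the clamped extension). [cite: Balaban1985RegularSpaces, p.98 ("We apply a gauge transformation to U₀ …"); Balaban1987RG1, (0.4) p.253] -/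
theorem localGaugeZ_mem {L s : ℕ} (hLs : L = 2 * s + 1) (hL : 2 ≤ L) {G : Subgroup 𝔸ˣ} (hG : AvgClosedZ d L G) (k : ℕ)
    (U₀ : Site d → Fin d → 𝔸ˣ) (hU : ∀ x κ, U₀ x κ ∈ G) {α₀ : ℝ} (hα : 0 < α₀)
    (hα3 : C0Z d * (α₀ * (L : ℝ) ^ 2) ≤ 1 / 3) (hα2 : 2 * (α₀ * (L : ℝ) ^ 2) ≤ c2' d L)
    {lo hi : Site d} (hlohi : lo ≤ hi)
    (h17 : pdevOn (tlo L lo k) (thi L hi k) U₀ < α₀ * (L : ℝ) ^ 2 * (((L : ℝ) ^ k)⁻¹) ^ 2) (y x : Site d) :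
    localGaugeZ L lo hi U₀ k y x ∈ G := by
  have hUU : ∀ x κ, U₀ x κ ∈ U1 𝔸 := fun x κ => hG.le_U1 (hU x κ)
  exact (B8Ineq128Rec.gaugeFix_global hLs hL hG k _ (clampCfg_mem hU) hα hα3 hα2
    ((pdev_clampCfg_le (tlo_le_thi L hlohi k) hUU).trans_lt h17) y).1 x

/-- ★★★ (RECORD TWIN of `B8Prop6OfThm4.prop6_of_thm4`.) **PROPOSITION 6 FROM THEOREM 4, FOR THE RECORD's AVERAGING STRUCTURE** (p. 99: «the assumptions of Theorem 4 are
satisfied for the pair of configurations `1, U₀″`, thus there exists a gauge transformation `u` such that `U₁ = U₀″^{u⁻¹}` satisfies the conditions (1.36)–(1.39)»).  HYPOTHESES: the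
setting of Sect. F as in `B8Eq131CubesRec.ineq132_cubes` (`G` `AvgClosedZ`, odd `L = 2s + 1 ≥ 3`, `d ≥ 1`, `U₀` `G`-valued in `𝔄_k({Ω_j}, α₀)`, «□̃ ⊂ Ω_{k−1}» for the CENTRED blow-up
`tcubeZ`, `1 ≤ R₁M₁ = ρ ≤ M`, `11d < M`, the smallness of (1.130)), Theorem 4 for the record in the shape `Thm4AtOneZ`, and `α₀′ + α₁′ = L³α₀ + 6dL²Mα₀ ≤ c₁`.  CONCLUSION: a
`G`-valued `u` with `Restr u` such that `U₁ = U₀″^{u⁻¹}` (`U₀″ = cutFixedZ …`) has `Concl (L³α₀) (6dL²Mα₀) U₀″ u`; unique among such; `w := v⁻¹u` `G`-valued (`v = localGaugeZ …`); and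
(1.135): `U₀^{w⁻¹} = U₀″^{u⁻¹}` on the bonds of the centred `□̃` (`[tlo k, thi k]` over `[tLo, tHi]`). [cite: Balaban1985RegularSpaces, Prop. 6 (1.135) p.99, p.99 (paragraph after (1.133)), Thm. 4 p.88; Balaban1987RG1, (0.4) p.253] -/
theorem prop6_of_thm4 {L s : ℕ} (hLs : L = 2 * s + 1) (hL : 2 ≤ L) (hd : 1 ≤ d) {G : Subgroup 𝔸ˣ} (hG : AvgClosedZ d L G) (k : ℕ)
    (U₀ : Site d → Fin d → 𝔸ˣ) (hU : ∀ x κ, U₀ x κ ∈ G) {α₀ : ℝ} (hα : 0 < α₀)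
    (hα3 : C0Z d * (α₀ * (L : ℝ) ^ 2) ≤ 1 / 3) (hα2 : 2 * (α₀ * (L : ℝ) ^ 2) ≤ c2' d L)
    (a : Site d) {M ρ : ℕ} (hρ : 1 ≤ ρ) (hρM : ρ ≤ M) (hM : 11 * (d : ℝ) < M)
    {η : ℝ} (hη : 0 < η) {Ω : ℕ → Set (Site d)} (hA : InAk L k η α₀ Ω U₀) (hT : tcubeZ L a M ρ k ⊆ Ω (k - 1))
    (hsmall : 11 * (d : ℝ) ^ 2 * (L : ℝ) ^ 2 * α₀ + ((M : ℝ) + 4 * ρ) * d * (L : ℝ) ^ 2 * α₀ ≤ 1 / 6)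
    {c₁ : ℝ} {Restr : (Site d → 𝔸ˣ) → Prop} {Concl : ℝ → ℝ → (Site d → Fin d → 𝔸ˣ) → (Site d → 𝔸ˣ) → Prop}
    (hThm4 : Thm4AtOneZ L k η c₁ G a M ρ Restr Concl)
    (hc₁ : (L : ℝ) ^ 3 * α₀ + 6 * d * (L : ℝ) ^ 2 * M * α₀ ≤ c₁) :
    ∃ u : Site d → 𝔸ˣ, (∀ x, u x ∈ G) ∧ Restr u ∧
      Concl ((L : ℝ) ^ 3 * α₀) (6 * d * (L : ℝ) ^ 2 * M * α₀)
        (cutFixedZ L (tLo a ρ) (tHi a M ρ) U₀ k (ctr a M)) u ∧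
      (∀ u' : Site d → 𝔸ˣ, (∀ x, u' x ∈ G) → Restr u' →
        Concl ((L : ℝ) ^ 3 * α₀) (6 * d * (L : ℝ) ^ 2 * M * α₀)
          (cutFixedZ L (tLo a ρ) (tHi a M ρ) U₀ k (ctr a M)) u' → u' = u) ∧
      (∀ x, ((localGaugeZ L (tLo a ρ) (tHi a M ρ) U₀ k (ctr a M))⁻¹ * u) x ∈ G) ∧
      AgreeOn (tlo L (tLo a ρ) k) (thi L (tHi a M ρ) k)
        (gaugeAct ((localGaugeZ L (tLo a ρ) (tHi a M ρ) U₀ k (ctr a M))⁻¹ * u)⁻¹ U₀)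
        (gaugeAct u⁻¹ (cutFixedZ L (tLo a ρ) (tHi a M ρ) U₀ k (ctr a M))) := by
  have hL1 : 1 ≤ L := le_trans (by norm_num) hL
  have hM1 : 1 ≤ M := hρ.trans hρM
  have hLpos : (0 : ℝ) < L := by exact_mod_cast lt_of_lt_of_le (by norm_num) hL
  have hdpos : (0 : ℝ) < d := by exact_mod_cast hd
  have hMpos : (0 : ℝ) < M := by exact_mod_cast hM1
  have hα₀' : 0 < (L : ℝ) ^ 3 * α₀ := by positivity
  have hα₁' : 0 < 6 * (d : ℝ) * (L : ℝ) ^ 2 * M * α₀ := by positivity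
  obtain ⟨h132a, h132b, h133⟩ := ineq132_cubes hLs hL hd hG k U₀ hU hα hα3 hα2 a hρ hρM hM hη hA hT hsmall
  have hΩ : ∃ l, l ≤ k ∧ k ≤ l + 1 ∧ ∀ x, InBox (tlo L (tLo a ρ) k) (thi L (tHi a M ρ) k) x → x ∈ Ω l :=
    ⟨k - 1, Nat.sub_le _ _, by omega, fun x hx => hT hx⟩
  have hvG : ∀ x, localGaugeZ L (tLo a ρ) (tHi a M ρ) U₀ k (ctr a M) x ∈ G :=
    localGaugeZ_mem hLs hL hG k U₀ hU hα hα3 hα2 (tLo_le_tHi hM1) (pdevOn_lt_of_inAk_box hL1 hα hA hΩ) (ctr a M)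
  have hU''G : ∀ x κ, cutFixedZ L (tLo a ρ) (tHi a M ρ) U₀ k (ctr a M) x κ ∈ G :=
    cutCfg_mem (gaugeAct_mem_of hU hvG)
  have h166 : Cond166CubeZ L k a M ρ (1 : Site d → Fin d → 𝔸ˣ) (cutFixedZ L (tLo a ρ) (tHi a M ρ) U₀ k (ctr a M))
      (6 * d * (L : ℝ) ^ 2 * M * α₀) :=
    (cond166CubeZ_one_iff L k a M ρ _ _).2 h133
  obtain ⟨u, ⟨huG, hR, hC⟩, huniq⟩ :=
    hThm4 hα₀' hα₁' hc₁ _ hU''G (one_inAk hL1 k hη hα₀' _) h132a h132b h166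
  exact ⟨u, huG, hR, hC, huniq, fun x => G.mul_mem (G.inv_mem (hvG x)) (huG x),
    agree135 _ _ U₀ _ u⟩

/-- (RECORD TWIN of `B8Prop6OfThm4.prop6_of_thm4_printed`.) **Proposition 6 from Theorem 4 for the record with the PRINTED smallness «`7dL²Mα₀ ≤ c₁`»** (and the implicit
`L ≤ dM`, `smallness_134`). [cite: Balaban1985RegularSpaces, Prop. 6 p.99; Balaban1987RG1, (0.4) p.253] -/
theorem prop6_of_thm4_printed {L s : ℕ} (hLs : L = 2 * s + 1) (hL : 2 ≤ L) (hd : 1 ≤ d) {G : Subgroup 𝔸ˣ} (hG : AvgClosedZ d L G)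
    (k : ℕ) (U₀ : Site d → Fin d → 𝔸ˣ) (hU : ∀ x κ, U₀ x κ ∈ G) {α₀ : ℝ} (hα : 0 < α₀)
    (hα3 : C0Z d * (α₀ * (L : ℝ) ^ 2) ≤ 1 / 3) (hα2 : 2 * (α₀ * (L : ℝ) ^ 2) ≤ c2' d L)
    (a : Site d) {M ρ : ℕ} (hρ : 1 ≤ ρ) (hρM : ρ ≤ M) (hM : 11 * (d : ℝ) < M) (hLdM : (L : ℝ) ≤ d * M)
    {η : ℝ} (hη : 0 < η) {Ω : ℕ → Set (Site d)} (hA : InAk L k η α₀ Ω U₀) (hT : tcubeZ L a M ρ k ⊆ Ω (k - 1))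
    (hsmall : 11 * (d : ℝ) ^ 2 * (L : ℝ) ^ 2 * α₀ + ((M : ℝ) + 4 * ρ) * d * (L : ℝ) ^ 2 * α₀ ≤ 1 / 6)
    {c₁ : ℝ} {Restr : (Site d → 𝔸ˣ) → Prop} {Concl : ℝ → ℝ → (Site d → Fin d → 𝔸ˣ) → (Site d → 𝔸ˣ) → Prop}
    (hThm4 : Thm4AtOneZ L k η c₁ G a M ρ Restr Concl) (hc₁ : 7 * d * (L : ℝ) ^ 2 * M * α₀ ≤ c₁) :
    ∃ u : Site d → 𝔸ˣ, (∀ x, u x ∈ G) ∧ Restr u ∧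
      Concl ((L : ℝ) ^ 3 * α₀) (6 * d * (L : ℝ) ^ 2 * M * α₀)
        (cutFixedZ L (tLo a ρ) (tHi a M ρ) U₀ k (ctr a M)) u ∧
      (∀ u' : Site d → 𝔸ˣ, (∀ x, u' x ∈ G) → Restr u' →
        Concl ((L : ℝ) ^ 3 * α₀) (6 * d * (L : ℝ) ^ 2 * M * α₀)
          (cutFixedZ L (tLo a ρ) (tHi a M ρ) U₀ k (ctr a M)) u' → u' = u) ∧
      (∀ x, ((localGaugeZ L (tLo a ρ) (tHi a M ρ) U₀ k (ctr a M))⁻¹ * u) x ∈ G) ∧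
      AgreeOn (tlo L (tLo a ρ) k) (thi L (tHi a M ρ) k)
        (gaugeAct ((localGaugeZ L (tLo a ρ) (tHi a M ρ) U₀ k (ctr a M))⁻¹ * u)⁻¹ U₀)
        (gaugeAct u⁻¹ (cutFixedZ L (tLo a ρ) (tHi a M ρ) U₀ k (ctr a M))) :=
  prop6_of_thm4 hLs hL hd hG k U₀ hU hα hα3 hα2 a hρ hρM hM hη hA hT hsmall hThm4
    (smallness_134 (by exact_mod_cast lt_of_lt_of_le (by norm_num) hL) hα hLdM hc₁)

/-! ## §4. (1.137): `|(1/i) log Ū₀′ᵏ(x, x′)| ≤ |x − y|₁·4α₀ ≤ 2dMα₀` on `□^{(k)}`, for THIS `U₀′`, record averages -/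

/-- ★ (RECORD TWIN of `B8Prop6OfThm4.ineq137_cube`.) **(1.137), THE INEQUALITIES, AND `\overline{U₀″}ᵏ = Ū₀′ᵏ` ON `□^{(k)}`, RECORD AVERAGES** (p. 99).  HYPOTHESES: `G`
`AvgClosedZ`, odd `L = 2s + 1 ≥ 3`, `U₀` `G`-valued in `𝔄_k({Ω_j}, α₀)` with «□̃ ⊂ Ω_{k−1}» and «□ ⊂ Ω_k» (p. 98) for the CENTRED `tcubeZ`, `boxZ`, `M ≥ 1`, `α₀L²` Prop.-1∕2-small for
the record (`C₀ᶻ`), `dMα₀ ≤ 1∕2`.  CONCLUSION, for `U₀′ = U₀^{v}` (`v = localGaugeZ …`, the gauge of p. 98 with the global axial gauge of `Ū₀′ᵏ` at the centre `y = ctr a M` — the SHARED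
centre-rooted staircase system, token (T3)), `U₀″ = cutFixedZ …`, and every bond `⟨x, x + e_μ⟩ ⊂ □^{(k)} = [a, a + M − 1]ᵈ`: `\overline{U₀″}ᵏ(x, x + e_μ) = Ū₀′ᵏ(x, x + e_μ)`,
`‖(1∕i) log Ū₀′ᵏ(x, x + e_μ)‖ ≤ |x − y|₁·4α₀` and `|x − y|₁·4α₀ ≤ 2dMα₀`. [cite: Balaban1985RegularSpaces, Prop. 6 (1.137) p.99, (1.128)-(1.129) p.98; Balaban1985Averaging, Prop. 2 p.26; Balaban1987RG1, (0.3)-(0.4) pp.252-253] -/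
theorem ineq137_cube {L s : ℕ} (hLs : L = 2 * s + 1) (hL : 2 ≤ L) {G : Subgroup 𝔸ˣ} (hG : AvgClosedZ d L G) (k : ℕ)
    (U₀ : Site d → Fin d → 𝔸ˣ) (hU : ∀ x κ, U₀ x κ ∈ G) {α₀ : ℝ} (hα : 0 < α₀)
    (hα3 : C0Z d * (α₀ * (L : ℝ) ^ 2) ≤ 1 / 3) (hα2 : 2 * (α₀ * (L : ℝ) ^ 2) ≤ c2' d L)
    (a : Site d) {M : ℕ} (ρ : ℕ) (hM1 : 1 ≤ M) {η : ℝ} {Ω : ℕ → Set (Site d)} (hA : InAk L k η α₀ Ω U₀)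
    (hT : tcubeZ L a M ρ k ⊆ Ω (k - 1)) (hbox : boxZ L a M k ⊆ Ω k) (hsmall : (d : ℝ) * M * α₀ ≤ 1 / 2)
    (x : Site d) (μ : Fin d) (hx : bLoZ L a 0 0 ≤ x) (hx' : x + e μ ≤ bHiZ L a M 0 0) :
    avgIterZ L (cutFixedZ L (tLo a ρ) (tHi a M ρ) U₀ k (ctr a M)) k x μ =
        avgIterZ L (gaugeAct (localGaugeZ L (tLo a ρ) (tHi a M ρ) U₀ k (ctr a M)) U₀) k x μ ∧
      ‖(Complex.I⁻¹ : ℂ) •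
          mlog ((avgIterZ L (gaugeAct (localGaugeZ L (tLo a ρ) (tHi a M ρ) U₀ k (ctr a M)) U₀) k x μ : 𝔸ˣ) :
            𝔸)‖ ≤ l1 (x - ctr a M) * (4 * α₀) ∧
      (l1 (x - ctr a M) : ℝ) * (4 * α₀) ≤ 2 * d * M * α₀ := by
  have hLo : Odd L := ⟨s, hLs⟩
  have hL1 : 1 ≤ L := le_trans (by norm_num) hL
  have hL0 : 0 < L := hL1
  have hLr : (1 : ℝ) ≤ L := by exact_mod_cast hL1
  have hUU : ∀ z κ, U₀ z κ ∈ U1 𝔸 := fun z κ => hG.le_U1 (hU z κ)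
  have hlohi : tLo a ρ ≤ tHi a M ρ := tLo_le_tHi hM1
  have hkk : ∀ i, tlo L (tLo a ρ) k i ≤ thi L (tHi a M ρ) k i := tlo_le_thi L hlohi k
  -- the global carrier `Uc = π*(U₀|□̃)` and (1.7) on `□̃ ⊂ Ω_{k-1}`
  set Uc := clampCfg (tlo L (tLo a ρ) k) (thi L (tHi a M ρ) k) U₀ with hUc
  have hUcG : ∀ z κ, Uc z κ ∈ G := clampCfg_mem hU
  have hΩ : ∃ l, l ≤ k ∧ k ≤ l + 1 ∧ ∀ z, InBox (tlo L (tLo a ρ) k) (thi L (tHi a M ρ) k) z → z ∈ Ω l :=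
    ⟨k - 1, Nat.sub_le _ _, by omega, fun z hz => hT hz⟩
  have h17 : pdevOn (tlo L (tLo a ρ) k) (thi L (tHi a M ρ) k) U₀ <
      α₀ * (L : ℝ) ^ 2 * (((L : ℝ) ^ k)⁻¹) ^ 2 := pdevOn_lt_of_inAk_box hL1 hα hA hΩ
  have h17c : pdev Uc < α₀ * (L : ℝ) ^ 2 * (((L : ℝ) ^ k)⁻¹) ^ 2 := (pdev_clampCfg_le hkk hUU).trans_lt h17
  -- the gauge `v` of p. 98 on the global carrier: `G`-valued, global axial gauge of the top level at `y`
  obtain ⟨hvG, hUc'G, hpdev', -, -, hgax⟩ := B8Ineq128Rec.gaugeFix_global hLs hL hG k Uc hUcG hα hα3 hα2 h17c (ctr a M)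
  set Uc' := gaugeAct (towerGaugeZ L Uc k (ctr a M)) Uc with hUc'
  have hvU : ∀ z, localGaugeZ L (tLo a ρ) (tHi a M ρ) U₀ k (ctr a M) z ∈ U1 𝔸 := fun z => hG.le_U1 (hvG z)
  have h17c' : pdev Uc' < α₀ * (L : ℝ) ^ 2 * (((L : ℝ) ^ k)⁻¹) ^ 2 := by rw [hpdev']; exact h17c
  -- `W = Ū_c′ᵏ` is `G`-valued everywhere (Proposition 2 of [3] for the record, `B8Ineq128Rec.ineq128_global`)
  have hW : ∀ z κ, avgIterZ L Uc' k z κ ∈ U1 𝔸 := fun z κ =>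
    hG.le_U1 ((ineq128_global L hL hG k Uc' hUc'G hα hα3 hα2 h17c' 0 (Nat.zero_le _)).2 k
      (Nat.sub_zero k).ge z κ)
  -- `U₀′` and `U_c′` agree on the bonds of `□̃`, hence on those of `□ ⊂ □̃`
  have hagc : AgreeOn (tlo L (tLo a ρ) k) (thi L (tHi a M ρ) k) Uc'
      (gaugeAct (localGaugeZ L (tLo a ρ) (tHi a M ρ) U₀ k (ctr a M)) U₀) :=
    gaugeAct_agree (clampCfg_agree U₀) _
  have hsubk : tlo L (tLo a ρ) k ≤ tlo L (bLoZ L a 0 0) k ∧ thi L (bHiZ L a M 0 0) k ≤ thi L (tHi a M ρ) k := by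
    rw [tlo_tLo hLo, thi_tHi hLo, tlo_bLo hLo, thi_bHi hLo, Nat.zero_add, Nat.mul_zero]
    exact le_of_margin_mono (Nat.zero_le _)
  have hsub0 : tLo a ρ ≤ bLoZ L a 0 0 ∧ bHiZ L a M 0 0 ≤ tHi a M ρ := by
    rw [tLo_eq L, tHi_eq L]
    exact le_of_margin_mono (Nat.zero_le _)
  -- (1.7) at level `k` on `□ ⊂ Ω_k`, moved to `U_c′`: `sup_{p ⊂ □} |U_c′(∂p) − 1| < α₀L^{−2k}`
  have hboxΩ : ∀ z, InBox (tlo L (bLoZ L a 0 0) k) (thi L (bHiZ L a M 0 0) k) z → z ∈ Ω k := by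
    intro z hz
    refine hbox ?_
    rw [tlo_bLo hLo, thi_bHi hLo, Nat.zero_add, Nat.mul_zero] at hz
    exact hz
  have h17top : pdevOn (tlo L (bLoZ L a 0 0) k) (thi L (bHiZ L a M 0 0) k) Uc' <
      α₀ * (((L : ℝ) ^ k)⁻¹) ^ 2 := by
    rw [pdevOn_congr (hagc.mono (fun i => hsubk.1 i) fun i => hsubk.2 i), pdevOn_gaugeAct hvU]
    exact pdevOn_lt_of_inAk_top hL1 hα hA hboxΩ
  -- Proposition 2 of [3] for the record, localised to the tower over `□^{(k)}` with `α₀/L²` for `α₀`: `|W(∂p′) − 1| < 2α₀`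
  have hLsq : (0 : ℝ) < (L : ℝ) ^ 2 := by positivity
  set α' : ℝ := α₀ / (L : ℝ) ^ 2 with hα'
  have hα'eq : α' * (L : ℝ) ^ 2 = α₀ := div_mul_cancel₀ α₀ hLsq.ne'
  have hα'pos : 0 < α' := div_pos hα hLsq
  have hαle : α₀ ≤ α₀ * (L : ℝ) ^ 2 := le_mul_of_one_le_right hα.le (one_le_pow₀ hLr)
  have hα3' : C0Z d * (α' * (L : ℝ) ^ 2) ≤ 1 / 3 := by
    rw [hα'eq]; exact (mul_le_mul_of_nonneg_left hαle (C0Z_pos d).le).trans hα3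
  have hα2' : 2 * (α' * (L : ℝ) ^ 2) ≤ c2' d L := by rw [hα'eq]; linarith
  have h17' : pdevOn (tlo L (bLoZ L a 0 0) k) (thi L (bHiZ L a M 0 0) k) Uc' <
      α' * (L : ℝ) ^ 2 * (((L : ℝ) ^ k)⁻¹) ^ 2 := by rw [hα'eq]; exact h17top
  have hlohi0 : bLoZ L a 0 0 ≤ bHiZ L a M 0 0 := fun i => by
    have hM1' : (1 : ℤ) ≤ M := by exact_mod_cast hM1
    have h0 : ctrShift L 0 = 0 := by simp [ctrShift]
    simp only [bLoZ, bHiZ, pow_zero, one_mul, h0, Nat.cast_zero, sub_zero, add_zero]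
    omega
  have h128 : B8Lemma1NonAbelian.PlaqSmall (avgIterZ L Uc' k) (bLoZ L a 0 0) (bHiZ L a M 0 0) (2 * α₀) := by
    intro z κ μ' _ hz hz'
    have h := ineq128_local hLs hL hG k Uc' hUc'G hα'pos hα3' hα2' (bLoZ L a 0 0) (bHiZ L a M 0 0) hlohi0 h17' 0
      (Nat.zero_le _) z κ μ' hz hz'
    rw [Nat.sub_zero] at h
    refine h.le.trans (le_of_eq ?_)
    simp only [aLev, pow_zero, inv_one, one_pow, mul_one]
    rw [mul_assoc, hα'eq]
  -- geometry of `□^{(k)} = [a, a + M − 1]^d` about `y = ctr a M = a + ⌊(M − 1)/2⌋`, radius `⌊M/2⌋`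
  have g1 : ((M - 1) / 2 : ℕ) ≤ M / 2 := Nat.div_le_div_right (Nat.sub_le _ _)
  have g2 : M - 1 - (M - 1) / 2 ≤ M / 2 := by omega
  have g3 : ((M - 1) / 2 : ℕ) ≤ M - 1 := Nat.div_le_self _ _
  have h0 : ctrShift L 0 = 0 := by simp [ctrShift]
  have hy0 : bLoZ L a 0 0 ≤ ctr a M := fun i => by
    simp only [bLoZ, ctr, pow_zero, one_mul, h0, Nat.cast_zero, sub_zero]; omega
  have hy0' : ctr a M ≤ bHiZ L a M 0 0 := fun i => by
    simp only [bHiZ, ctr, pow_zero, one_mul, h0, Nat.cast_zero, add_zero]; omega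
  have hrad0 : ∀ i, ctr a M i - bLoZ L a 0 0 i ≤ (M / 2 : ℕ) ∧ bHiZ L a M 0 0 i - ctr a M i ≤ (M / 2 : ℕ) :=
    fun i => by
      constructor <;> simp only [bLoZ, bHiZ, ctr, pow_zero, one_mul, h0, Nat.cast_zero, sub_zero, add_zero] <;> omega
  have hside : 2 * ((M / 2 : ℕ) : ℝ) ≤ (M : ℝ) := by
    have : 2 * (M / 2) ≤ M := by omega
    exact_mod_cast this
  -- the axial gauge of `W` at `y` (everywhere, in particular on `□^{(k)}`), `u := 1`
  have hax : ∀ z, bLoZ L a 0 0 ≤ z → z ≤ bHiZ L a M 0 0 →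
      hol (gaugeAct (1 : Site d → 𝔸ˣ) (avgIterZ L Uc' k)) (ctr a M) (treeWord (z - ctr a M)) = 1 :=
    fun z _ _ => by rw [gaugeAct_one]; exact hgax z
  have h137 := ineq137_log_printed (avgIterZ L Uc' k) hW hy0 hy0' hrad0 hα.le h128 1 (U1 𝔸).one_mem hax hside
    hsmall x μ hx hx'
  rw [gaugeAct_one] at h137
  -- back to `U₀′` and `U₀″` on the bonds of `□^{(k)} ⊂ □̃^{(k)}` (locality of the record average)
  have hxt : tlo L (tLo a ρ) 0 ≤ x := fun i => (hsub0.1 i).trans (hx i)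
  have hxt' : x + e μ ≤ thi L (tHi a M ρ) 0 := fun i => (hx' i).trans (hsub0.2 i)
  have hag'' : AgreeOn (tlo L (tLo a ρ) k) (thi L (tHi a M ρ) k)
      (cutFixedZ L (tLo a ρ) (tHi a M ρ) U₀ k (ctr a M)) Uc' :=
    fun z κ hz hz' => (cutCfg_agree _ _ _ z κ hz hz').trans (hagc.symm z κ hz hz')
  have e1 := avgIterZ_eq_of_agree hLs hag'' (Nat.zero_le k) hxt hxt'
  have e2 := avgIterZ_eq_of_agree hLs hagc.symm (Nat.zero_le k) hxt hxt'
  rw [Nat.sub_zero] at e1 e2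
  refine ⟨e1.trans e2.symm, ?_, h137.2⟩
  rw [e2]
  exact h137.1

end Analytic

end Literature.MathematicalPhysics.QuantumFieldTheory.Balaban1983to89.B8Prop6OfThm4Rec
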